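import Mathlib
import Summits.ResolutionOfSingularities.ResolutionOfSingularities.Theorems.HomologicalConductorPersistenceSurfaceSaturationResidualFourToric
import HarnessLib

/-!
# Rung S-2 `PersistenceSurface` (stmt-ResolutionOfSingularities-19970) — the DOOR OF RECORD with the analytically-toric
# exemption of stub C1

[OURS · cell decomp-res · rung S-2; seat leafhand-res-homologicalconduct-17 gen 0]  Nothing here is a statement of the
manuscript under review (Hironaka 2017); AI-written, weaker than expert review.  DEF-FREE.  Nothing is asserted: every
premise is a hypothesis (typed Props of the chain or inline).

The registered skeleton (core v3, 1a77c002) closes the route decl `PersistenceSurface` BY NAME from the three door stubs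
C1 `SaturationFourSurfaceResidual₄`, C2 `CompletedStepPersistenceRationalNormal'`, C3′ `LevelFourPersistenceNonnormalOrNonrational'`
through `persistenceSurface_of_residual₄_of_completedStep'_of_rest'`.  With the toric `Sat₄` theorem of this seat in route
currency (`…SaturationResidualFourToric.saturationFourSurfaceResidual₄_of_toric_exemption`), stub C1 may be replaced by its
ANALYTICALLY-TORIC EXEMPTION: `Sat₄` is demanded only at the residual stages that are not analytically toric (a stage counts as
analytically toric when its completion is a domain ring-isomorphic to the completion of a localisation of some
`U = k₀[u,v]^{(n;1,q)}`, `gcd(q,n) = 1`, at its vertex).  Same shape as `…PersistenceSurfaceDoorNonGorenstein` (hand 2).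

* `persistenceSurface_of_toricExemptSat_of_completedStep'_of_rest'` — THE DOOR.

References: S. B. Iyengar, R. Takahashi, IMRN 2016 [`IyengarTakahashi2014`]; A. Bahlekeh, E. Hakimian, S. Salarian, R. Takahashi,
Q. J. Math. 67 (2016), Thm. 4.5 [`BahlekehHakimianSalarianTakahashi2015`] — through landed tree lemmas only.
-/

-- single-problem summit: the doubled namespace component `ResolutionOfSingularities` is forced
set_option linter.dupNamespace false

noncomputable section

open IsLocalRing MvPolynomial
open Summit.ResolutionOfSingularities.ResolutionOfSingularities.Theorems
open Summit.ResolutionOfSingularities.ResolutionOfSingularities.Theorems.NoZeno.Birth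
open Summit.ResolutionOfSingularities.ResolutionOfSingularities.Theorems.HomologicalConductor.PersistenceSurfaceSaturationResidual
open Summit.ResolutionOfSingularities.ResolutionOfSingularities.Theorems.HomologicalConductor.PersistenceSurfaceSaturationResidualThree
open Summit.ResolutionOfSingularities.ResolutionOfSingularities.Theorems.HomologicalConductor.PersistenceSurfaceSaturationResidualFour
open Summit.ResolutionOfSingularities.ResolutionOfSingularities.Theorems.HomologicalConductor.PersistenceSurfaceCompletedStepLevelFree
open Summit.ResolutionOfSingularities.ResolutionOfSingularities.Theorems.HomologicalConductor.PersistenceCyclicQuotientVertexIsolated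
  (X_pow_mem)
open Summit.ResolutionOfSingularities.ResolutionOfSingularities.Theorems.HomologicalConductor.PersistenceSurfaceSaturationResidualFourToric
  (saturationFourSurfaceResidual₄_of_toric_exemption)

namespace Summit.ResolutionOfSingularities.ResolutionOfSingularities.Theorems.HomologicalConductor.PersistenceSurfaceDoorToric

/-- **Door of record with the analytically-toric exemption (end of hand leafhand-res-homologicalconduct-17-g0).**
`PersistenceSurface` (the route decl, by name) follows from: (T) at every residual stage `↥(tower O A m)` (not regular, not a
monic-hypersurface localisation, not an edim-candidate, singular successor, Krull dimension `2`) EITHER the stage is analytically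
toric (`T̂` a domain, `T̂ ≃+* Ŝ` for a noetherian local localisation `S` of some `U = k₀[u,v]^{(n;1,q)}`, `gcd(q,n) = 1`, at its
vertex) OR `ca T ⊆ caAt 4 T`; (C2) CSP‴ `CompletedStepPersistenceRationalNormal'`; (C3′)
`LevelFourPersistenceNonnormalOrNonrational'`.  The toric alternative is discharged by
`…CyclicQuotientCompletionSatFourMinimal.cohomologyAnnihilator_le_caAt_four_of_ringEquiv_completion_vertex'`.
[cite: BahlekehHakimianSalarianTakahashi2015, Thm. 4.5; IyengarTakahashi2014, §2] -/
theorem persistenceSurface_of_toricExemptSat_of_completedStep'_of_rest'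
    (hT : ∀ p : ℕ, p.Prime → ∀ (k K : Type) [Field k] [CharP k p] [Field K] [Algebra k K]
      (O : ValuationSubring K) (A : Subalgebra k K), (∀ c : k, algebraMap k K c ∈ O) → A.FG →
      IsFractionRing ↥A K → A.toSubring ≤ O.toSubring → ringKrullDim ↥A ≤ 2 → ∀ m : ℕ,
      ¬ IsRegularLocalRing ↥(tower O A m) → ¬ IsMonicHypersurfaceLocalization k 2 ↥(tower O A m) →
      ¬ IsEdimHypersurfaceCandidate 2 ↥(tower O A m) → ¬ IsRegularLocalRing ↥(tower O A (m + 1)) →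
      ringKrullDim ↥(tower O A m) = (2 : ℕ) →
      (∀ [IsLocalRing ↥(tower O A m)],
        IsDomain (AdicCompletion (maximalIdeal ↥(tower O A m)) ↥(tower O A m)) ∧
        ∃ (k₀ : Type) (_ : Field k₀) (n : ℕ) (_ : NeZero n) (q : ℕ) (U : Subalgebra k₀ (MvPolynomial (Fin 2) k₀))
          (hU : ∀ p, p ∈ U ↔ weightedHomogeneousComponent (![1, (q : ZMod n)] : Fin 2 → ZMod n) 0 p = p)
          (_ : q.Coprime n) (𝔪 : Ideal U) (_ : 𝔪.IsMaximal)
          (_ : (⟨(X 0 : MvPolynomial (Fin 2) k₀) ^ n, X_pow_mem U hU 0⟩ : U) ∈ 𝔪)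
          (_ : (⟨(X 1 : MvPolynomial (Fin 2) k₀) ^ n, X_pow_mem U hU 1⟩ : U) ∈ 𝔪)
          (S : Type) (_ : CommRing S) (_ : Algebra U S) (_ : IsLocalization.AtPrime S 𝔪) (_ : IsNoetherianRing S)
          (_ : IsLocalRing S),
          Nonempty (AdicCompletion (maximalIdeal ↥(tower O A m)) ↥(tower O A m) ≃+* AdicCompletion (maximalIdeal S) S)) ∨
      {x : K | ∃ hx : x ∈ tower O A m, ∃ n : ℕ, ∀ i : ℕ, n ≤ i → ∀ (M N : ModuleCat.{0} ↥(tower O A m)),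
          Module.Finite ↥(tower O A m) M → Module.Finite ↥(tower O A m) N →
            ∀ e : CategoryTheory.Abelian.Ext.{0} M N i, (⟨x, hx⟩ : ↥(tower O A m)) • e = 0} ⊆
        {x : K | ∃ hx : x ∈ tower O A m, ∀ i : ℕ, 4 ≤ i → ∀ (M N : ModuleCat.{0} ↥(tower O A m)),
          Module.Finite ↥(tower O A m) M → Module.Finite ↥(tower O A m) N →
            ∀ e : CategoryTheory.Abelian.Ext.{0} M N i, (⟨x, hx⟩ : ↥(tower O A m)) • e = 0})
    (hC : CompletedStepPersistenceRationalNormal') (hN : LevelFourPersistenceNonnormalOrNonrational') :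
    Summit.ResolutionOfSingularities.ResolutionOfSingularities.Theses.HomologicalConductor.PersistenceSurface :=
  persistenceSurface_of_residual₄_of_completedStep'_of_rest' (saturationFourSurfaceResidual₄_of_toric_exemption hT) hC hN

end Summit.ResolutionOfSingularities.ResolutionOfSingularities.Theorems.HomologicalConductor.PersistenceSurfaceDoorToric

end
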